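import Mathlib
import HarnessLib
import Summits.ValiantsHypothesis.ValiantsHypothesis.Theorems.LacunarySymmetroidMatrixDescartesProductPlusOneEulerSectorsTop

/-!
# ValiantsHypothesis / LacunarySymmetroid — crux `MatrixDescartes` (stmt-ValiantsHypothesis-18050, V1),
# LINE (A) «product_plus_one», S4″ residue: the COHERENT no-dip sector — EVERY support ratio

p7 g14's tame sector (✓ `…TameCalculus`: `x^{−p}·θ ln ∏ g_j` strictly decreasing) needs the ratio window `q ≤ 4p`
(`key_identity` ends exactly at 4).  With the weight `x^{−(q−1)}` instead of `x^{−p}` the per-factor derivative numerator is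
`R = −p(q−p−1)·ab·X + q·ac·Y − [(q−1)p b² X² − β bc XY + (q−1)q c² Y²]`, `β = p² − 3pq + p + q` (`X = x^p`, `Y = x^q`), and the bracket
is a POSITIVE SEMIDEFINITE form for EVERY `1 ≤ p < q` (`4(q−1)²pq − β² > 0`, `disc_pos`): so for COHERENT no-dip factors — `a c < 0` AND
`a b ≥ 0` (the middle coefficient on the side of the constant term, or zero) — `Ξ = x^{−k}·Ψ` is strictly decreasing on zero-free intervals
with NO ratio hypothesis (`hasDerivAt_xisum_neg`, `xi_injective`).  Consequences (bottom coupling `l₀ = 0`, any `d 0 < d 1 < d 2`):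

* ★ `eulerBound_coherent`: `Z₊(eulerNumerator d a 0) ≤ 2m + 2` for factors with `a_{j0} a_{j2} < 0`, `a_{j0} a_{j1} ≥ 0`;
* ★ `coherent_sector_class`: every member `C c·X^{m d 0} + ∏ f_j` has `Z₊ ≤ 2m + 3` (✓ `card_pos_roots_class_le_euler`).

* ★ `eulerBound_coherentTop` / `coherent_sector_class_top`: the mirror statements at the TOP coupling `l₀ = 2` under `a_{j2} a_{j1} ≥ 0`
  (reversal, ✓ `card_pos_roots_euler_le_reverse` / `eulerNumerator_reverse_top`).

(The ratio-4 barrier is thus confined to INCOHERENT no-dip factors, `a b < 0` at the bottom / `c b < 0` at the top — p7's «transitioned»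
factors, memo §10.)  Honest framing: a sector rung of the research stub; NOT `stub_eulerBoundK3` /
`stub_classRowK3` / `MatrixDescartes` / B; `VP ≠ VNP` NOT proved.  No definitions, no named facts.
-/

set_option linter.dupNamespace false

namespace Summit.ValiantsHypothesis.ValiantsHypothesis.Theorems.LacunarySymmetroidMatrixDescartes

namespace ProductPlusOne

open Polynomial Finset
open scoped BigOperators

/-! ### §1 The discriminant and the key inequality (every ratio) -/

/-- `4 (q−1)² p q − β² > 0` for `p = e+1`, `q = e+k+2`, `β = p² − 3pq + p + q` (explicit expansion with nonnegative coefficients).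
[folklore] -/
theorem disc_pos (e k : ℕ) :
    0 < 4 * ((e : ℝ) + k + 1) ^ 2 * ((e : ℝ) + 1) * ((e : ℝ) + k + 2)
      - (((e : ℝ) + 1) ^ 2 - 3 * ((e : ℝ) + 1) * ((e : ℝ) + k + 2) + ((e : ℝ) + 1) + ((e : ℝ) + k + 2)) ^ 2 := by
  have he : (0 : ℝ) ≤ e := Nat.cast_nonneg e
  have hk : (0 : ℝ) ≤ k := Nat.cast_nonneg k
  have hid : 4 * ((e : ℝ) + k + 1) ^ 2 * ((e : ℝ) + 1) * ((e : ℝ) + k + 2)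
      - (((e : ℝ) + 1) ^ 2 - 3 * ((e : ℝ) + 1) * ((e : ℝ) + k + 2) + ((e : ℝ) + 1) + ((e : ℝ) + k + 2)) ^ 2
      = 4 + 12 * k + 12 * k ^ 2 + 4 * k ^ 3 + 8 * e + 20 * e * k + 16 * e * k ^ 2 + 4 * e * k ^ 3
        + 3 * e ^ 2 + 6 * e ^ 2 * k + 3 * e ^ 2 * k ^ 2 := by ring
  rw [hid]
  positivity

/-- **The bracket is positive semidefinite**: `(q−1)p·B² − β·B·Cz + (q−1)q·Cz² ≥ 0` for all real `B, Cz`. [folklore] -/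
theorem bracket_nonneg (e k : ℕ) (B Cz : ℝ) :
    0 ≤ ((e : ℝ) + k + 1) * ((e : ℝ) + 1) * B ^ 2
      - (((e : ℝ) + 1) ^ 2 - 3 * ((e : ℝ) + 1) * ((e : ℝ) + k + 2) + ((e : ℝ) + 1) + ((e : ℝ) + k + 2)) * B * Cz
      + ((e : ℝ) + k + 1) * ((e : ℝ) + k + 2) * Cz ^ 2 := by
  set p : ℝ := (e : ℝ) + 1 with hp
  set w : ℝ := (e : ℝ) + k + 1 with hw
  set q : ℝ := (e : ℝ) + k + 2 with hq
  set β : ℝ := p ^ 2 - 3 * p * q + p + q with hβ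
  have hwp : 0 < w * p := by positivity
  have hD : 0 < 4 * w ^ 2 * p * q - β ^ 2 := by
    have := disc_pos e k
    simp only [hβ, hp, hw, hq]
    linarith
  -- `4wp·(bracket) = (2wp B − β Cz)² + (4w²pq − β²) Cz²`
  have hid : 4 * (w * p) * (w * p * B ^ 2 - β * B * Cz + w * q * Cz ^ 2)
      = (2 * w * p * B - β * Cz) ^ 2 + (4 * w ^ 2 * p * q - β ^ 2) * Cz ^ 2 := by ring
  have h4 : 0 ≤ 4 * (w * p) * (w * p * B ^ 2 - β * B * Cz + w * q * Cz ^ 2) := by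
    rw [hid]; positivity
  have := (mul_nonneg_iff_of_pos_left (by positivity : (0:ℝ) < 4 * (w * p))).1 h4
  linarith

/-- **The key inequality, every ratio**: for `a c < 0`, `a b ≥ 0`, `x > 0`:
`g·(q c x^{k+1} − k p b) − x^p·(p b + q c x^{k+1})² < 0`, `g = a + b x^p + c x^q`. [this file's lemma] -/
theorem numerator_neg_coherent (a b c : ℝ) (e k : ℕ) (hac : a * c < 0) (hab : 0 ≤ a * b) {x : ℝ} (hx : 0 < x) :
    (a + b * x ^ (e + 1) + c * x ^ (e + k + 2)) * (((e : ℝ) + k + 2) * c * x ^ (k + 1) - (k : ℝ) * ((e : ℝ) + 1) * b)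
      - x ^ (e + 1) * (((e : ℝ) + 1) * b + ((e : ℝ) + k + 2) * c * x ^ (k + 1)) ^ 2 < 0 := by
  have hX : 0 < x ^ (e + 1) := pow_pos hx _
  have hY : 0 < x ^ (e + k + 2) := pow_pos hx _
  -- multiply by `X = x^p > 0` and expand: `X·LHS = −k p ab X + q ac Y − [bracket(bX, cY)]`
  have hid : x ^ (e + 1) * ((a + b * x ^ (e + 1) + c * x ^ (e + k + 2))
        * (((e : ℝ) + k + 2) * c * x ^ (k + 1) - (k : ℝ) * ((e : ℝ) + 1) * b)
        - x ^ (e + 1) * (((e : ℝ) + 1) * b + ((e : ℝ) + k + 2) * c * x ^ (k + 1)) ^ 2)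
      = -((k : ℝ) * ((e : ℝ) + 1)) * (a * b) * x ^ (e + 1) + ((e : ℝ) + k + 2) * (a * c) * x ^ (e + k + 2)
        - (((e : ℝ) + k + 1) * ((e : ℝ) + 1) * (b * x ^ (e + 1)) ^ 2
          - (((e : ℝ) + 1) ^ 2 - 3 * ((e : ℝ) + 1) * ((e : ℝ) + k + 2) + ((e : ℝ) + 1) + ((e : ℝ) + k + 2))
            * (b * x ^ (e + 1)) * (c * x ^ (e + k + 2))
          + ((e : ℝ) + k + 1) * ((e : ℝ) + k + 2) * (c * x ^ (e + k + 2)) ^ 2) := by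
    ring
  have h1 : -((k : ℝ) * ((e : ℝ) + 1)) * (a * b) * x ^ (e + 1) ≤ 0 := by
    have : 0 ≤ ((k : ℝ) * ((e : ℝ) + 1)) * (a * b) * x ^ (e + 1) := by positivity
    linarith
  have h2 : ((e : ℝ) + k + 2) * (a * c) * x ^ (e + k + 2) < 0 :=
    mul_neg_of_neg_of_pos (mul_neg_of_pos_of_neg (by positivity) hac) hY
  have h3 := bracket_nonneg e k (b * x ^ (e + 1)) (c * x ^ (e + k + 2))
  have hneg : x ^ (e + 1) * ((a + b * x ^ (e + 1) + c * x ^ (e + k + 2))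
        * (((e : ℝ) + k + 2) * c * x ^ (k + 1) - (k : ℝ) * ((e : ℝ) + 1) * b)
        - x ^ (e + 1) * (((e : ℝ) + 1) * b + ((e : ℝ) + k + 2) * c * x ^ (k + 1)) ^ 2) < 0 := by
    rw [hid]; linarith
  by_contra hcon
  push Not at hcon
  exact absurd hneg (not_lt.2 (mul_nonneg hX.le hcon))

/-! ### §2 `Ξ = x^{−k}·Ψ` is strictly decreasing (coherent no-dip factors, every ratio) -/

/-- Per-factor derivative of `Ξ_j(y) = (p b + q c y^{k+1}) / (y^k·g(y))`, and it is NEGATIVE (`a c < 0`, `a b ≥ 0`, `x > 0`, `g(x) ≠ 0`).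
[this file's lemma] -/
theorem hasDerivAt_xi_neg (a b c : ℝ) (e k : ℕ) (hac : a * c < 0) (hab : 0 ≤ a * b) {x : ℝ} (hx : 0 < x)
    (hg : a + b * x ^ (e + 1) + c * x ^ (e + k + 2) ≠ 0) :
    ∃ D : ℝ, D < 0 ∧ HasDerivAt (fun y : ℝ => (((e : ℝ) + 1) * b + ((e : ℝ) + k + 2) * c * y ^ (k + 1))
        / (y ^ k * (a + b * y ^ (e + 1) + c * y ^ (e + k + 2)))) D x := by
  have hV : x ^ k * (a + b * x ^ (e + 1) + c * x ^ (e + k + 2)) ≠ 0 := mul_ne_zero (pow_ne_zero _ hx.ne') hg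
  have hnum : HasDerivAt (fun y : ℝ => ((e : ℝ) + 1) * b + ((e : ℝ) + k + 2) * c * y ^ (k + 1))
      (((e : ℝ) + k + 2) * c * (((k + 1 : ℕ) : ℝ) * x ^ (k + 1 - 1))) x :=
    ((hasDerivAt_pow (k + 1) x).const_mul (((e : ℝ) + k + 2) * c)).const_add _
  have hg' : HasDerivAt (fun y : ℝ => a + b * y ^ (e + 1) + c * y ^ (e + k + 2))
      (b * (((e + 1 : ℕ) : ℝ) * x ^ (e + 1 - 1)) + c * (((e + k + 2 : ℕ) : ℝ) * x ^ (e + k + 2 - 1))) x :=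
    (((hasDerivAt_pow (e + 1) x).const_mul b).const_add a).add ((hasDerivAt_pow (e + k + 2) x).const_mul c)
  have hden : HasDerivAt (fun y : ℝ => y ^ k * (a + b * y ^ (e + 1) + c * y ^ (e + k + 2)))
      (((k : ℕ) : ℝ) * x ^ (k - 1) * (a + b * x ^ (e + 1) + c * x ^ (e + k + 2))
        + x ^ k * (b * (((e + 1 : ℕ) : ℝ) * x ^ (e + 1 - 1)) + c * (((e + k + 2 : ℕ) : ℝ) * x ^ (e + k + 2 - 1)))) x :=
    (hasDerivAt_pow k x).mul hg'
  refine ⟨_, ?_, hnum.div hden hV⟩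
  -- the sign: `x · (U′V − UV′) = x^k · [g (q c x^{k+1} − k p b) − x^p U²] < 0`
  apply div_neg_of_neg_of_pos _ (by positivity)
  have hkey := numerator_neg_coherent a b c e k hac hab hx
  have hxk : 0 < x ^ k := pow_pos hx _
  -- identity after multiplying by `x`
  have hkx : x * (((k : ℕ) : ℝ) * x ^ (k - 1)) = (k : ℝ) * x ^ k := by
    rcases Nat.eq_zero_or_pos k with h0 | hpos
    · subst h0; simp
    · rw [← Nat.sub_add_cancel hpos]; simp [pow_succ]; ring
  have hid : x * (((e : ℝ) + k + 2) * c * (((k + 1 : ℕ) : ℝ) * x ^ (k + 1 - 1))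
        * (x ^ k * (a + b * x ^ (e + 1) + c * x ^ (e + k + 2)))
        - (((e : ℝ) + 1) * b + ((e : ℝ) + k + 2) * c * x ^ (k + 1))
          * (((k : ℕ) : ℝ) * x ^ (k - 1) * (a + b * x ^ (e + 1) + c * x ^ (e + k + 2))
            + x ^ k * (b * (((e + 1 : ℕ) : ℝ) * x ^ (e + 1 - 1)) + c * (((e + k + 2 : ℕ) : ℝ) * x ^ (e + k + 2 - 1)))))
      = x ^ k * ((a + b * x ^ (e + 1) + c * x ^ (e + k + 2))
          * (((e : ℝ) + k + 2) * c * x ^ (k + 1) - (k : ℝ) * ((e : ℝ) + 1) * b)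
        - x ^ (e + 1) * (((e : ℝ) + 1) * b + ((e : ℝ) + k + 2) * c * x ^ (k + 1)) ^ 2) := by
    have e1 : x * (((k : ℕ) : ℝ) * x ^ (k - 1) * (a + b * x ^ (e + 1) + c * x ^ (e + k + 2)))
        = (k : ℝ) * x ^ k * (a + b * x ^ (e + 1) + c * x ^ (e + k + 2)) := by
      rw [← mul_assoc, hkx]
    simp only [Nat.add_sub_cancel, show e + k + 2 - 1 = e + k + 1 by omega]
    push_cast
    have e2 : x * x ^ e = x ^ (e + 1) := by ring
    have e3 : x * x ^ (e + k + 1) = x ^ (e + k + 2) := by ring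
    -- expand: distribute the outer `x *`, use `e1` for the `k x^{k-1}` term
    have : x * ((((e : ℝ) + 1) * b + ((e : ℝ) + k + 2) * c * x ^ (k + 1))
          * (((k : ℝ)) * x ^ (k - 1) * (a + b * x ^ (e + 1) + c * x ^ (e + k + 2))
            + x ^ k * (b * (((e : ℝ) + 1) * x ^ e) + c * (((e : ℝ) + k + 2) * x ^ (e + k + 1)))))
        = (((e : ℝ) + 1) * b + ((e : ℝ) + k + 2) * c * x ^ (k + 1))
          * ((k : ℝ) * x ^ k * (a + b * x ^ (e + 1) + c * x ^ (e + k + 2))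
            + x ^ k * (b * (((e : ℝ) + 1) * x ^ (e + 1)) + c * (((e : ℝ) + k + 2) * x ^ (e + k + 2)))) := by
      rw [mul_left_comm, mul_add, e1, ← e2, ← e3]
      ring
    rw [mul_sub, this]
    ring
  have hlt : x * (((e : ℝ) + k + 2) * c * (((k + 1 : ℕ) : ℝ) * x ^ (k + 1 - 1))
        * (x ^ k * (a + b * x ^ (e + 1) + c * x ^ (e + k + 2)))
        - (((e : ℝ) + 1) * b + ((e : ℝ) + k + 2) * c * x ^ (k + 1))
          * (((k : ℕ) : ℝ) * x ^ (k - 1) * (a + b * x ^ (e + 1) + c * x ^ (e + k + 2))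
            + x ^ k * (b * (((e + 1 : ℕ) : ℝ) * x ^ (e + 1 - 1)) + c * (((e + k + 2 : ℕ) : ℝ) * x ^ (e + k + 2 - 1))))) < 0 := by
    rw [hid]; exact mul_neg_of_pos_of_neg hxk hkey
  by_contra hcon
  push Not at hcon
  exact absurd hlt (not_lt.2 (mul_nonneg hx.le hcon))

/-- **`Ξ′ < 0` for the sum** over `m ≥ 1` coherent no-dip factors, at every `x > 0` where no factor vanishes. [this file's theorem] -/
theorem hasDerivAt_xisum_neg {m : ℕ} (hm : 0 < m) (a b c : Fin m → ℝ) (e k : ℕ)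
    (hac : ∀ j, a j * c j < 0) (hab : ∀ j, 0 ≤ a j * b j) {x : ℝ} (hx : 0 < x)
    (hg : ∀ j, a j + b j * x ^ (e + 1) + c j * x ^ (e + k + 2) ≠ 0) :
    ∃ D : ℝ, D < 0 ∧ HasDerivAt (fun y : ℝ => ∑ j, (((e : ℝ) + 1) * b j + ((e : ℝ) + k + 2) * c j * y ^ (k + 1))
        / (y ^ k * (a j + b j * y ^ (e + 1) + c j * y ^ (e + k + 2)))) D x := by
  classical
  choose D hD using fun j => hasDerivAt_xi_neg (a j) (b j) (c j) e k (hac j) (hab j) hx (hg j)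
  refine ⟨∑ j, D j, ?_, ?_⟩
  · exact Finset.sum_neg (fun j _ => (hD j).1) ⟨⟨0, hm⟩, Finset.mem_univ _⟩
  · exact HasDerivAt.fun_sum (u := Finset.univ) (fun j _ => (hD j).2)

/-- Rolle for `Ξ`: on a zero-free interval `Ξ` does not take the same value twice (`m ≥ 1`). [this file's lemma] -/
theorem xi_injective {m : ℕ} (hm : 0 < m) (a b c : Fin m → ℝ) (e k : ℕ)
    (hac : ∀ j, a j * c j < 0) (hab : ∀ j, 0 ≤ a j * b j) {w₁ w₂ : ℝ} (hw₁ : 0 < w₁) (hw : w₁ < w₂)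
    (hfree : ∀ t ∈ Set.Icc w₁ w₂, ∀ j, a j + b j * t ^ (e + 1) + c j * t ^ (e + k + 2) ≠ 0)
    (heq : (∑ j, (((e : ℝ) + 1) * b j + ((e : ℝ) + k + 2) * c j * w₁ ^ (k + 1))
        / (w₁ ^ k * (a j + b j * w₁ ^ (e + 1) + c j * w₁ ^ (e + k + 2))))
      = ∑ j, (((e : ℝ) + 1) * b j + ((e : ℝ) + k + 2) * c j * w₂ ^ (k + 1))
        / (w₂ ^ k * (a j + b j * w₂ ^ (e + 1) + c j * w₂ ^ (e + k + 2)))) : False := by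
  have hcont : ContinuousOn (fun y : ℝ => ∑ j, (((e : ℝ) + 1) * b j + ((e : ℝ) + k + 2) * c j * y ^ (k + 1))
      / (y ^ k * (a j + b j * y ^ (e + 1) + c j * y ^ (e + k + 2)))) (Set.Icc w₁ w₂) := by
    intro t ht
    obtain ⟨D, _, hD⟩ := hasDerivAt_xisum_neg hm a b c e k hac hab (hw₁.trans_le ht.1) (hfree t ht)
    exact hD.continuousAt.continuousWithinAt
  obtain ⟨ξ, hξ, hξ'⟩ := exists_deriv_eq_zero hw hcont heq
  obtain ⟨D, hDneg, hD⟩ := hasDerivAt_xisum_neg hm a b c e k hac hab (hw₁.trans hξ.1) (hfree ξ ⟨hξ.1.le, hξ.2.le⟩)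
  rw [hD.deriv] at hξ'
  exact hDneg.ne hξ'

/-! ### §3 The counts (bottom coupling, every ratio) -/

/-- ★ **THE COHERENT SECTOR, Euler currency**: `d 0 < d 1 < d 2` (ANY ratio), `a_{j0} a_{j2} < 0`, `a_{j0} a_{j1} ≥ 0`, bottom coupling:
`Z₊(eulerNumerator d a 0) ≤ 2m + 2`. [this file's theorem] -/
theorem eulerBound_coherent {m : ℕ} (d : Fin 3 → ℕ) (h01 : d 0 < d 1) (h12 : d 1 < d 2)
    (a : Fin m → Fin 3 → ℝ) (hac : ∀ j, a j 0 * a j 2 < 0) (hab : ∀ j, 0 ≤ a j 0 * a j 1) :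
    ((∑ j, (∑ l, C (a j l * ((d l : ℝ) - d 0)) * X ^ (d l)) * ∏ i ∈ Finset.univ.erase j, (∑ l, C (a i l) * X ^ (d l))
      : ℝ[X]).roots.toFinset.filter (fun t => 0 < t)).card ≤ 2 * m + 2 := by
  classical
  rcases Nat.eq_zero_or_pos m with hm | hm
  · subst hm
    simp only [Finset.univ_eq_empty, Finset.sum_empty, roots_zero, Multiset.toFinset_zero, Finset.filter_empty,
      Finset.card_empty]
    exact Nat.zero_le _
  obtain ⟨e, he⟩ : ∃ e, d 1 = d 0 + e + 1 := ⟨d 1 - d 0 - 1, by omega⟩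
  obtain ⟨k, hk⟩ : ∃ k, d 2 = d 0 + e + k + 2 := ⟨d 2 - d 1 - 1, by omega⟩
  rw [eulerNumerator_eq d e k he hk a 0, card_pos_roots_X_pow_mul, sub_self, mul_zero]
  have hP0 := prod_trinomial_ne_zero (fun j => a j 0) (fun j => a j 1) (fun j => a j 2) e k hac
  have hZ := prod_trinomial_pos_roots_le (fun j => a j 0) (fun j => a j 1) (fun j => a j 2) e k hac
  have h := euler_pos_roots_le (fun j => a j 0) (fun j => a j 1) (fun j => a j 2) e k hP0 0 m hZ ?_
  · exact h.trans (by omega)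
  · -- `Φ(w) = w^{e+k+1}·Ξ(w)`: a zero of `Φ` is a zero of `Ξ`, and `Ξ` is injective on zero-free intervals
    intro w₁ w₂ hw₁ hw hfree h1 h2
    have hΞ : ∀ w : ℝ, 0 < w → (∀ j, a j 0 + a j 1 * w ^ (e + 1) + a j 2 * w ^ (e + k + 2) ≠ 0) →
        (∑ j, (((e : ℝ) + 1) * a j 1 * w ^ (e + 1) + ((e : ℝ) + k + 2) * a j 2 * w ^ (e + k + 2))
            / (a j 0 + a j 1 * w ^ (e + 1) + a j 2 * w ^ (e + k + 2))) = 0 →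
        (∑ j, (((e : ℝ) + 1) * a j 1 + ((e : ℝ) + k + 2) * a j 2 * w ^ (k + 1))
            / (w ^ k * (a j 0 + a j 1 * w ^ (e + 1) + a j 2 * w ^ (e + k + 2)))) = 0 := by
      intro w hw hg h
      have hwe : w ^ (e + k + 1) ≠ 0 := pow_ne_zero _ hw.ne'
      have key : (∑ j, (((e : ℝ) + 1) * a j 1 * w ^ (e + 1) + ((e : ℝ) + k + 2) * a j 2 * w ^ (e + k + 2))
            / (a j 0 + a j 1 * w ^ (e + 1) + a j 2 * w ^ (e + k + 2)))
          = w ^ (e + k + 1) * ∑ j, (((e : ℝ) + 1) * a j 1 + ((e : ℝ) + k + 2) * a j 2 * w ^ (k + 1))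
            / (w ^ k * (a j 0 + a j 1 * w ^ (e + 1) + a j 2 * w ^ (e + k + 2))) := by
        rw [Finset.mul_sum]
        refine Finset.sum_congr rfl fun j _ => ?_
        have hwk : w ^ k ≠ 0 := pow_ne_zero _ hw.ne'
        rw [mul_div_assoc', div_eq_div_iff (hg j) (mul_ne_zero hwk (hg j))]
        ring
      rw [key] at h
      exact (mul_eq_zero.1 h).resolve_left hwe
    exact xi_injective hm (fun j => a j 0) (fun j => a j 1) (fun j => a j 2) e k hac hab hw₁ hw hfree
      ((hΞ w₁ hw₁ (fun j => hfree w₁ ⟨le_rfl, hw.le⟩ j) h1).trans (hΞ w₂ (hw₁.trans hw) (fun j => hfree w₂ ⟨hw.le, le_rfl⟩ j) h2).symm)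

/-- ★ **THE COHERENT SECTOR, member count** (line shape, bottom coupling `l₀ = 0`, ANY ratio): `Z₊(C c·X^{m d 0} + ∏ f_j) ≤ 2m + 3`
(✓ `card_pos_roots_class_le_euler` + `eulerBound_coherent`). [this file's theorem] -/
theorem coherent_sector_class {m : ℕ} (d : Fin 3 → ℕ) (h01 : d 0 < d 1) (h12 : d 1 < d 2)
    (a : Fin m → Fin 3 → ℝ) (hac : ∀ j, a j 0 * a j 2 < 0) (hab : ∀ j, 0 ≤ a j 0 * a j 1) (c : ℝ) :
    ((C c * X ^ (m * d 0) + ∏ j, ∑ l, C (a j l) * X ^ (d l) : ℝ[X]).roots.toFinset.filter (fun t => 0 < t)).card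
      ≤ 2 * m + 3 :=
  (card_pos_roots_class_le_euler d a 0 c).trans (by have := eulerBound_coherent d h01 h12 a hac hab; omega)

/-- ★ **THE COHERENT SECTOR AT THE TOP COUPLING, Euler currency** (`a_{j0} a_{j2} < 0`, `a_{j2} a_{j1} ≥ 0`, ANY ratio, `l₀ = 2`):
`Z₊(eulerNumerator d a 2) ≤ 2m + 2`. [this file's theorem] -/
theorem eulerBound_coherentTop {m : ℕ} (d : Fin 3 → ℕ) (h01 : d 0 < d 1) (h12 : d 1 < d 2)
    (a : Fin m → Fin 3 → ℝ) (hac : ∀ j, a j 0 * a j 2 < 0) (hcb : ∀ j, 0 ≤ a j 2 * a j 1) :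
    ((∑ j, (∑ l, C (a j l * ((d l : ℝ) - d 2)) * X ^ (d l)) * ∏ i ∈ Finset.univ.erase j, (∑ l, C (a i l) * X ^ (d l))
      : ℝ[X]).roots.toFinset.filter (fun t => 0 < t)).card ≤ 2 * m + 2 := by
  classical
  have hD : ∀ l, d l ≤ d 2 := by
    intro l; fin_cases l
    · exact (h01.trans h12).le
    · exact h12.le
    · exact le_rfl
  refine (card_pos_roots_euler_le_reverse d (d 2) hD a 2).trans ?_
  rw [eulerNumerator_reverse_top d a]
  refine eulerBound_coherent _ ?_ ?_ _ (fun j => ?_) (fun j => ?_)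
  · show d 2 - d 2 < d 2 - d 1
    omega
  · show d 2 - d 1 < d 2 - d 0
    omega
  · show a j 2 * a j 0 < 0
    rw [mul_comm]; exact hac j
  · show 0 ≤ a j 2 * a j 1
    exact hcb j

/-- ★ **THE COHERENT SECTOR AT THE TOP COUPLING, member count** (line shape, `l₀ = 2`, ANY ratio): `Z₊ ≤ 2m + 3`. [this file's theorem] -/
theorem coherent_sector_class_top {m : ℕ} (d : Fin 3 → ℕ) (h01 : d 0 < d 1) (h12 : d 1 < d 2)
    (a : Fin m → Fin 3 → ℝ) (hac : ∀ j, a j 0 * a j 2 < 0) (hcb : ∀ j, 0 ≤ a j 2 * a j 1) (c : ℝ) :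
    ((C c * X ^ (m * d 2) + ∏ j, ∑ l, C (a j l) * X ^ (d l) : ℝ[X]).roots.toFinset.filter (fun t => 0 < t)).card
      ≤ 2 * m + 3 :=
  (card_pos_roots_class_le_euler d a 2 c).trans (by have := eulerBound_coherentTop d h01 h12 a hac hcb; omega)

end ProductPlusOne

end Summit.ValiantsHypothesis.ValiantsHypothesis.Theorems.LacunarySymmetroidMatrixDescartes
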